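import Summits.CriticalPhenomena.PercolationContinuityZ3.Theorems.PercNearOneGluingNoHeavyLowerTailBlockStep
import HarnessLib

/-!
# `NoHeavyLowerTail` (stmt-CriticalPhenomena-4575) — BLOCK WORST-FIRST GLUING for a block and a relay, and
# its unconditioned corollary

Support file (prover prim-gen-kcluster gen 3; `--supports stmt-CriticalPhenomena-4575`).  No definitions, no sorries.
Notation as in `…BlockStep.lean`: block `S`, relay `y`, sink `b`, observer `o`; `S ↮ b` = every `s ∈ S` cut from `b`,
`D_S = {S↮b} ∩ {y↮b}`, `L = D_S ∩ {y↮S}`.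

* `own_le_blockcut`: `P(o↔y | y↮S, y↮b) ≤ P(o↔y | L)` (adding the block's cut helps; one two-set exchange).
* `blockGluing_two` (PROVED): for `μ(y↮b) ≤ μ(S↮b)` and `μ(L) > 0`,
  `P(o↔S | S↮b) + P(o↔y, o↮S | y↮b) ≤ P(o↔S∪y | D_S)`; `blockWorstFirst_two`: the same `≤ 1`.
  With `S = {x}` this is worst-first gluing for two relays in the strengthened conditional form; with `S` the block
  of the worse relays it is the merge step of the k-relay induction under the prefix condition.
* Iterating (`S = {a₁}`, then `S = {a₁,a₂}`, …) proves worst-first gluing for every relay list with the prefix condition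
  `μ(a₁,…,a_{j−1} ↮ b) ≥ μ(a_j ↮ b)`; in particular the three-relay event gluing inequality when `μ(a₁↮b, a₂↮b) ≥ μ(a₃↮b)`.
-/

noncomputable section

namespace Summit.CriticalPhenomena.PercolationContinuityZ3.Theorems

open MeasureTheory Set Literature.Probability.LatticeModels Literature.Probability.Percolation
open scoped Classical BigOperators
open PathExchange (rs)

namespace BlockStep

variable {V : Type*}

/-- Raw exchange (`S_ex = {y}`, `T = insert b S`): with `G = {y↮b, y↮S}`,
`μ(G ∩ {y↔o}) · μ(G ∩ {b↮S}) ≤ μ(G ∩ {y↔o} ∩ {b↮S}) · μ(G)`.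
[cite: VandenbergHaggstromKahn2005, Thm. 2.1 (p. 9) at q = 1 with Remark 1 (p. 5) — corollary via `setTwoClusterExchange`, derived in this file] -/
theorem own_le_blockcut_set [Fintype V] (w : Sym2 V → unitInterval) (S : Finset V) (o b y : V) :
    (prodBernoulli w).real ({ω : BondConfig V | ∀ s ∈ ({y} : Set V), ∀ t ∈ (insert b ↑S : Set V),
        ¬ (openGraph ω).Reachable s t} ∩ ((openConn y o : Set (BondConfig V)) ∩ univ)) *
      (prodBernoulli w).real ({ω : BondConfig V | ∀ s ∈ ({y} : Set V), ∀ t ∈ (insert b ↑S : Set V),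
        ¬ (openGraph ω).Reachable s t} ∩ ((⋂ s ∈ S, (openConn b s : Set (BondConfig V))ᶜ) ∩ univ)) ≤
    (prodBernoulli w).real ({ω : BondConfig V | ∀ s ∈ ({y} : Set V), ∀ t ∈ (insert b ↑S : Set V),
        ¬ (openGraph ω).Reachable s t} ∩ ((openConn y o : Set (BondConfig V)) ∩
          ⋂ s ∈ S, (openConn b s : Set (BondConfig V))ᶜ)) *
      (prodBernoulli w).real ({ω : BondConfig V | ∀ s ∈ ({y} : Set V), ∀ t ∈ (insert b ↑S : Set V),
        ¬ (openGraph ω).Reachable s t} ∩ (univ ∩ univ)) := by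
  set Sx : Set V := {y} with hSx
  set T : Set V := insert b ↑S with hT
  have hyS : y ∈ Sx := by rw [hSx]; exact mem_singleton y
  have hbT : b ∈ T := by rw [hT]; exact mem_insert b _
  exact setTwoClusterExchange w Sx T (A₁ := (openConn y o : Set (BondConfig V)))
    (A₂ := ⋂ s ∈ S, (openConn b s : Set (BondConfig V))ᶜ) (B₁ := univ) (B₂ := univ)
    (fun ω ω' hs ht h => TwoSetExchange.typePlus_openConn_of_mem Sx T hyS o hs ht h)
    (fun ω ω' hs ht h => mem_iInter₂.2 fun s hsS =>
      TwoSetExchange.typePlus_not_openConn_of_mem Sx T hbT s hs ht (mem_iInter₂.1 h s hsS))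
    (fun _ _ _ _ _ => mem_univ _) (fun _ _ _ _ _ => mem_univ _)

/-- **Adding the block's cut helps `o ↔ y`.**  With `G = {y↮b} ∩ {y↮S}` and `L = {S↮b} ∩ {y↮b} ∩ {y↮S}`:
`μ({o↔y} ∩ G) · μ(L) ≤ μ({o↔y} ∩ L) · μ(G)`. [this file] -/
theorem own_le_blockcut [Fintype V] (w : Sym2 V → unitInterval) (S : Finset V) (o b y : V) :
    (prodBernoulli w).real ((openConn o y : Set (BondConfig V)) ∩
        ((openConn y b)ᶜ ∩ (⋃ s ∈ S, (openConn y s : Set (BondConfig V)))ᶜ)) *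
      (prodBernoulli w).real ({ω : BondConfig V | ∀ s ∈ S, ¬ (openGraph ω).Reachable s b} ∩ (openConn y b)ᶜ ∩
        (⋃ s ∈ S, (openConn y s : Set (BondConfig V)))ᶜ) ≤
    (prodBernoulli w).real ((openConn o y : Set (BondConfig V)) ∩
        ({ω | ∀ s ∈ S, ¬ (openGraph ω).Reachable s b} ∩ (openConn y b)ᶜ ∩
          (⋃ s ∈ S, (openConn y s : Set (BondConfig V)))ᶜ)) *
      (prodBernoulli w).real ((openConn y b : Set (BondConfig V))ᶜ ∩
        (⋃ s ∈ S, (openConn y s : Set (BondConfig V)))ᶜ) := by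
  have key := own_le_blockcut_set w S o b y
  set R : Set (BondConfig V) := {ω : BondConfig V | ∀ s ∈ ({y} : Set V), ∀ t ∈ (insert b ↑S : Set V),
        ¬ (openGraph ω).Reachable s t} with hRdef
  have hR : ∀ ω : BondConfig V, ω ∈ R ↔
      ω ∈ ((openConn y b : Set (BondConfig V))ᶜ ∩ (⋃ s ∈ S, (openConn y s : Set (BondConfig V)))ᶜ) := by
    intro ω
    simp only [hRdef, mem_setOf_eq, mem_singleton_iff, forall_eq, mem_insert_iff, Finset.mem_coe, forall_eq_or_imp,
      mem_inter_iff, mem_compl_iff, mem_iUnion₂, openConn, not_exists]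
  have hSB : ∀ ω : BondConfig V, ω ∈ (⋂ s ∈ S, (openConn b s : Set (BondConfig V))ᶜ) ↔
      ω ∈ {ω : BondConfig V | ∀ s ∈ S, ¬ (openGraph ω).Reachable s b} := by
    intro ω
    simp only [mem_iInter₂, mem_compl_iff, openConn, mem_setOf_eq]
    exact ⟨fun h s hs hsb => h s hs (rs hsb), fun h s hs hbs => h s hs (rs hbs)⟩
  have hOy : ∀ ω : BondConfig V, ω ∈ (openConn y o : Set (BondConfig V)) ↔ ω ∈ (openConn o y : Set (BondConfig V)) :=
    fun ω => ⟨fun h => rs h, fun h => rs h⟩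
  have e1 : R ∩ ((openConn y o : Set (BondConfig V)) ∩ univ) = (openConn o y : Set (BondConfig V)) ∩
      ((openConn y b)ᶜ ∩ (⋃ s ∈ S, (openConn y s : Set (BondConfig V)))ᶜ) := by
    ext ω; simp only [mem_inter_iff, mem_univ, and_true, hR ω, hOy ω]; tauto
  have e2 : R ∩ ((⋂ s ∈ S, (openConn b s : Set (BondConfig V))ᶜ) ∩ univ) =
      {ω : BondConfig V | ∀ s ∈ S, ¬ (openGraph ω).Reachable s b} ∩ (openConn y b)ᶜ ∩
        (⋃ s ∈ S, (openConn y s : Set (BondConfig V)))ᶜ := by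
    ext ω; simp only [mem_inter_iff, mem_univ, and_true, hR ω, hSB ω]; tauto
  have e3 : R ∩ ((openConn y o : Set (BondConfig V)) ∩ ⋂ s ∈ S, (openConn b s : Set (BondConfig V))ᶜ) =
      (openConn o y : Set (BondConfig V)) ∩ ({ω | ∀ s ∈ S, ¬ (openGraph ω).Reachable s b} ∩ (openConn y b)ᶜ ∩
        (⋃ s ∈ S, (openConn y s : Set (BondConfig V)))ᶜ) := by
    ext ω; simp only [mem_inter_iff, hR ω, hOy ω, hSB ω]; tauto
  have e4 : R ∩ (univ ∩ univ) = ((openConn y b : Set (BondConfig V))ᶜ ∩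
      (⋃ s ∈ S, (openConn y s : Set (BondConfig V)))ᶜ) := by
    ext ω; rw [mem_inter_iff, hR]; simp only [mem_univ, and_true, inter_univ]
  rw [e1, e2, e3, e4] at key
  exact key

/-- **Block worst-first gluing for a block and a relay, conditional form (PROVED).**  For a finite vertex set
`S` and vertices `o, b, y` with `μ(y↮b) ≤ μ(S↮b)` and `μ(L) > 0`:
`P(o↔S | S↮b) + P(o↔y, o↮S | y↮b) ≤ P(o↔S∪y | S↮b, y↮b)`, in denominator form
`μ({o↔S}∩{S↮b})/μ(S↮b) + μ({o↔y}∩{o↮S}∩{y↮b})/μ(y↮b) ≤ μ(({o↔S}∪{o↔y})∩D_S)/μ(D_S)`. [this file] -/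
theorem blockGluing_two [Fintype V] (w : Sym2 V → unitInterval) (S : Finset V) (o b y : V)
    (hord : (prodBernoulli w).real (openConn y b : Set (BondConfig V))ᶜ ≤
      (prodBernoulli w).real {ω : BondConfig V | ∀ s ∈ S, ¬ (openGraph ω).Reachable s b})
    (hL : 0 < (prodBernoulli w).real ({ω : BondConfig V | ∀ s ∈ S, ¬ (openGraph ω).Reachable s b} ∩
      (openConn y b)ᶜ ∩ (⋃ s ∈ S, (openConn y s : Set (BondConfig V)))ᶜ)) :
    (prodBernoulli w).real ((⋃ s ∈ S, (openConn o s : Set (BondConfig V))) ∩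
          {ω | ∀ s ∈ S, ¬ (openGraph ω).Reachable s b}) /
        (prodBernoulli w).real {ω : BondConfig V | ∀ s ∈ S, ¬ (openGraph ω).Reachable s b} +
      (prodBernoulli w).real ((openConn o y : Set (BondConfig V)) ∩
          (⋃ s ∈ S, (openConn o s : Set (BondConfig V)))ᶜ ∩ (openConn y b)ᶜ) /
        (prodBernoulli w).real (openConn y b : Set (BondConfig V))ᶜ ≤
    (prodBernoulli w).real (((⋃ s ∈ S, (openConn o s : Set (BondConfig V))) ∪ openConn o y) ∩
        ({ω | ∀ s ∈ S, ¬ (openGraph ω).Reachable s b} ∩ (openConn y b)ᶜ)) /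
      (prodBernoulli w).real ({ω : BondConfig V | ∀ s ∈ S, ¬ (openGraph ω).Reachable s b} ∩ (openConn y b)ᶜ) := by
  set μ := prodBernoulli w with hμ
  set SB : Set (BondConfig V) := {ω : BondConfig V | ∀ s ∈ S, ¬ (openGraph ω).Reachable s b} with hSB
  set Yb : Set (BondConfig V) := (openConn y b : Set (BondConfig V)) with hYb
  set YU : Set (BondConfig V) := ⋃ s ∈ S, (openConn y s : Set (BondConfig V)) with hYU
  set OS : Set (BondConfig V) := ⋃ s ∈ S, (openConn o s : Set (BondConfig V)) with hOSd
  set Oy : Set (BondConfig V) := (openConn o y : Set (BondConfig V)) with hOy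
  have step := blockStep w S o b y hord hL
  -- `{o↔y} ∩ {o↮S} = {o↔y} ∩ {y↮S}`
  have eG : Oy ∩ OSᶜ ∩ Ybᶜ = Oy ∩ (Ybᶜ ∩ YUᶜ) := by
    ext ω
    simp only [mem_inter_iff, mem_compl_iff, hOy, hOSd, hYU, hYb, mem_iUnion₂, openConn, mem_setOf_eq, not_exists]
    constructor
    · rintro ⟨⟨hoy, hoS⟩, hyb⟩; exact ⟨hoy, hyb, fun s hs hys => hoS s hs (hoy.trans hys)⟩
    · rintro ⟨hoy, hyb, hyS⟩; exact ⟨⟨hoy, fun s hs hos => hyS s hs ((rs hoy).trans hos)⟩, hyb⟩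
  have row := own_le_blockcut w S o b y
  -- the second term is dominated by the block-step term
  set a := μ.real (Oy ∩ (Ybᶜ ∩ YUᶜ)) with ha
  set gv := μ.real (Ybᶜ ∩ YUᶜ) with hgv
  set q := μ.real (SB ∩ Ybᶜ ∩ YUᶜ) with hq
  set nyL := μ.real (Oy ∩ (SB ∩ Ybᶜ ∩ YUᶜ)) with hnyL
  set dy := μ.real Ybᶜ with hdy
  have hdy0 : 0 ≤ dy := measureReal_nonneg
  have hrow : a * q ≤ nyL * gv := row
  have hale : a ≤ gv * nyL / q := by rw [le_div_iff₀ hL]; linarith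
  have h2 : a / dy ≤ gv / dy * (nyL / q) :=
    calc a / dy ≤ (gv * nyL / q) / dy := div_le_div_of_nonneg_right hale hdy0
      _ = gv / dy * (nyL / q) := by ring
  have hcomm : μ.real (YUᶜ ∩ Ybᶜ) = gv := by rw [hgv, inter_comm]
  rw [hcomm] at step
  rw [eG]
  exact (add_le_add le_rfl h2).trans step

/-- **Block worst-first gluing for a block and a relay (PROVED):** under the hypotheses of `blockGluing_two`,
`P(o↔S | S↮b) + P(o↔y, o↮S | y↮b) ≤ 1`. [this file] -/
theorem blockWorstFirst_two [Fintype V] (w : Sym2 V → unitInterval) (S : Finset V) (o b y : V)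
    (hord : (prodBernoulli w).real (openConn y b : Set (BondConfig V))ᶜ ≤
      (prodBernoulli w).real {ω : BondConfig V | ∀ s ∈ S, ¬ (openGraph ω).Reachable s b})
    (hL : 0 < (prodBernoulli w).real ({ω : BondConfig V | ∀ s ∈ S, ¬ (openGraph ω).Reachable s b} ∩
      (openConn y b)ᶜ ∩ (⋃ s ∈ S, (openConn y s : Set (BondConfig V)))ᶜ)) :
    (prodBernoulli w).real ((⋃ s ∈ S, (openConn o s : Set (BondConfig V))) ∩
          {ω | ∀ s ∈ S, ¬ (openGraph ω).Reachable s b}) /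
        (prodBernoulli w).real {ω : BondConfig V | ∀ s ∈ S, ¬ (openGraph ω).Reachable s b} +
      (prodBernoulli w).real ((openConn o y : Set (BondConfig V)) ∩
          (⋃ s ∈ S, (openConn o s : Set (BondConfig V)))ᶜ ∩ (openConn y b)ᶜ) /
        (prodBernoulli w).real (openConn y b : Set (BondConfig V))ᶜ ≤ 1 := by
  refine (blockGluing_two w S o b y hord hL).trans ?_
  exact div_le_one_of_le₀ (measureReal_mono Set.inter_subset_right) measureReal_nonneg

end BlockStep

end Summit.CriticalPhenomena.PercolationContinuityZ3.Theorems

end
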